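import Summits.AtomisticToContinuum.BoseEinsteinCondensation.Theorems.BECConjugateDominationInfraredMinimumUncertaintyLadder
import Summits.AtomisticToContinuum.BoseEinsteinCondensation.Theorems.BECConjugateDominationInfraredMinimumUncertaintySteinIdentity
import Summits.AtomisticToContinuum.BoseEinsteinCondensation.Theorems.BECConjugateDominationInfraredMinimumUncertaintyWeakEulerLagrange
import Summits.AtomisticToContinuum.BoseEinsteinCondensation.Theorems.BECConjugateDominationInfraredMinimumUncertaintyStubCoherenceRegular
import Summits.AtomisticToContinuum.BoseEinsteinCondensation.Theorems.InfraredMinimumUncertainty.Negative.PhaseSteinDominationNecessity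
import HarnessLib

/-!
# Route `BECConjugateDomination`, crux `InfraredMinimumUncertainty` (stmt-AtomisticToContinuum-11784):
# the lead's cut of the hardest stub FD into its Stein-form core (line `fisher-gaussian-density-mode`, reshape r1)

Lead prover-line-stmt-AtomisticToContinuum-11784-0, 2026-08-16. The registered gen-2 stub
`stub_phaseFisherDomination` (FD: `∃ φ continuous, 16 ν_m ≤ C · J_m(φ)`) was cut into four registered stubs,
FD ⇐ `SteinIdentity ∧ WeakEulerLagrange ∧ CoherenceRegular ∧ PhaseSteinDomination`. This file records the
four statements (bodies = the registered stub signatures verbatim, self-contained and let-free, in the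
vocabulary of `Theorems/BECConjugateDominationDefs.lean`; they could not be appended there: 400-line cap),
closes three of them by the landed stub theorems, and proves the cut's logic:

* `steinIdentity_holds`, `weakEulerLagrange_holds`, `coherenceRegular_holds` — the three provable stubs ARE
  theorems of the tree (`Theorems.ImuSteinIdentity.stub_steinIdentity` p77744,
  `Theorems.ImuWeakEulerLagrange.stub_weakEulerLagrange` p78669,
  `Theorems.BECConjugateDomination.stub_coherenceRegular` p77078);
* `fisherTestV_eq_steinInline` — by the Stein identity, on `C¹` fields, real states and `m ≠ 0`, the lifted
  Fisher functional `fisherTestV` equals its derivative-free (Stein) form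
  `J^S_m(φ) = −(4/N) Re∫(N ∂φ(Z) − ∂̄φ(Z) Z̄^{(2)})|Ψ|² − ∫|φ(Z)|²|Ψ|²` (a functional of the joint law of the
  first two harmonics `(ρ_k, ρ_{2k})` under `|Ψ|²dX`);
* `fisherDominationV_of_parts` — the cut: the four statements give `FisherDominationV`;
* `imu_of_phaseStein_of_fisherGaussianity` — `PhaseSteinDomination → FisherGaussianityV →
  InfraredMinimumUncertainty` (sufficiency of the open core together with FG, via the tree's `imu_of_fisher`);
* `phaseSteinDomination_of_imu` — `InfraredMinimumUncertainty → PhaseSteinDomination` (NECESSITY, `C = 4C₀ + 4`,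
  linear `C¹` field; = the drefute seat's landed `Negative.stub_phaseSteinDomination_of_imu`, p82312).

So the open core PSD is equivalent to the crux modulo FG, with explicit constants, and every provable part
of the line is in the tree. Nothing here is a fact taken on trust: the four `def … : Prop` are statements,
three of them proved below, the fourth (PSD) open and consumed only as a hypothesis.
-/

noncomputable section

open MeasureTheory Filter Set Metric
open scoped ENNReal NNReal Topology ComplexConjugate BigOperators

namespace Summit.AtomisticToContinuum.BoseEinsteinCondensation.Cruxes.InfraredMinimumUncertainty.FisherGaussianDensityMode

open Literature.MathematicalPhysics.QuantumManyBody.BoseGas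
open Summit.AtomisticToContinuum.BoseEinsteinCondensation.Theses.BECConjugateDomination
  (InfraredMinimumUncertainty)
open Summit.AtomisticToContinuum.BoseEinsteinCondensation.Theorems.CorrectorClosure.Negative
  (sideLength_succ_pos)

/-! ## The four statements of the cut (bodies = registered stub signatures verbatim) -/

/-- **SteinIdentity** (statement of the registered stub `stub_steinIdentity`; proved: `steinIdentity_holds`):
for a real-valued periodic `C¹` state, every mode `m` and every `C¹` field `φ`,
`Re ∫ φ̄(Z_m) W_m Ψ̄ dX = ‖k‖² · Re ∫ (N ∂φ(Z_m) − ∂̄φ(Z_m) Z̄^{(2)}_m) |Ψ|² dX`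
(`∂φ = ½(Dφ·1 − iDφ·i)`, `∂̄φ = ½(Dφ·1 + iDφ·i)` the Wirtinger derivatives of the real-differentiable field,
`Z^{(2)}_m = ∑ⱼ e_m(xⱼ)²`). With `φ = id` it is the f-sum identity. A statement (proved below). -/
def SteinIdentity : Prop :=
  ∀ (n : ℕ) (L : ℝ), 0 < L → ∀ Ψ : PeriodicTrialState (n + 1) L, (∀ X, Ψ.ψ X = (‖Ψ.ψ X‖ : ℂ)) →
    ∀ (m : Fin 3 → ℤ) (φ : ℂ → ℂ), ContDiff ℝ 1 φ →
      (∫ X in cellN (n + 1) L, (starRingEnd ℂ (φ (∑ j : Fin (n + 1), cellWave L m (X j))) *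
          (∑ j : Fin (n + 1), cellWave L m (X j) *
            (((‖((2 * Real.pi / L) • latticeVec 1 m)‖ ^ 2 : ℝ) : ℂ) * Ψ.ψ X -
              2 * Complex.I * fderiv ℝ Ψ.ψ X (Pi.single j ((2 * Real.pi / L) • latticeVec 1 m)))) *
          starRingEnd ℂ (Ψ.ψ X)).re) =
        ‖((2 * Real.pi / L) • latticeVec 1 m)‖ ^ 2 *
          ∫ X in cellN (n + 1) L,
            ((((n : ℝ) + 1 : ℝ) : ℂ) *
                ((fderiv ℝ φ (∑ j : Fin (n + 1), cellWave L m (X j)) 1 -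
                    Complex.I * fderiv ℝ φ (∑ j : Fin (n + 1), cellWave L m (X j)) Complex.I) / 2) -
              (fderiv ℝ φ (∑ j : Fin (n + 1), cellWave L m (X j)) 1 +
                    Complex.I * fderiv ℝ φ (∑ j : Fin (n + 1), cellWave L m (X j)) Complex.I) / 2 *
                starRingEnd ℂ (∑ j : Fin (n + 1), cellWave L m (X j) ^ 2)).re * ‖Ψ.ψ X‖ ^ 2

/-- **WeakEulerLagrange** (statement of the registered stub `stub_weakEulerLagrange`; proved:
`weakEulerLagrange_holds`): a finite-energy minimiser of the periodic `N`-body energy in the `C¹` periodic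
Bose class satisfies the weak eigen-equation `Re q(η, Ψ) = E₀ · Re ⟨η, Ψ⟩` for every `C¹` periodic
Bose-symmetric test function `η` (first variation of the Rayleigh quotient). A statement (proved below). -/
def WeakEulerLagrange : Prop :=
  ∀ v : ℝ → ℝ≥0∞, IsRepulsiveFiniteRange v → (∀ r, v r ≠ ⊤) →
    ContDiff ℝ 2 (fun x : Space => (v ‖x‖).toReal) →
    (∃ Cₑ : ℝ, ∀ x : Space,
      ‖iteratedFDeriv ℝ 2 (fun x : Space => (v ‖x‖).toReal) x‖ ≤ Cₑ * Real.sqrt ((v ‖x‖).toReal)) →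
    ∀ (n : ℕ) (L : ℝ), 0 < L → ∀ Ψ : PeriodicTrialState (n + 1) L,
      periodicEnergy v Ψ = periodicGroundStateEnergy v (n + 1) L → periodicEnergy v Ψ ≠ ⊤ →
      ∀ η : Config (n + 1) → ℂ, ContDiff ℝ 1 η →
        (∀ (X : Config (n + 1)) (i : Fin (n + 1)) (k : Fin 3),
          η (X + Pi.single i (EuclideanSpace.single k L)) = η X) →
        (∀ (σ : Equiv.Perm (Fin (n + 1))) (X : Config (n + 1)), η (X ∘ σ) = η X) →
        (∫ X in cellN (n + 1) L,
            ((∑ i : Fin (n + 1), ∑ k : Fin 3,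
                (starRingEnd ℂ (fderiv ℝ η X (Pi.single i (EuclideanSpace.single k (1 : ℝ)))) *
                  fderiv ℝ Ψ.ψ X (Pi.single i (EuclideanSpace.single k (1 : ℝ)))).re) +
              (periodicInteraction v L X).toReal * (starRingEnd ℂ (η X) * Ψ.ψ X).re)) =
          (periodicGroundStateEnergy v (n + 1) L).toReal *
            ∫ X in cellN (n + 1) L, (starRingEnd ℂ (η X) * Ψ.ψ X).re

/-- **CoherenceRegular** (statement of the registered stub `stub_coherenceRegular`; proved:
`coherenceRegular_holds`): for a pointwise non-vanishing periodic `C¹` state the coherence `g` is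
continuous, strictly positive, `≤ 1`, `= 1` at `0`, even and `Lℤ³`-periodic. A statement (proved below). -/
def CoherenceRegular : Prop :=
  ∀ (n : ℕ) (L : ℝ), 0 < L → ∀ Ψ : PeriodicTrialState (n + 1) L, (∀ X, Ψ.ψ X ≠ 0) →
    Continuous (fun r : Space => ∫ x in cell L, ∫ Y in cellN n L,
        ‖Ψ.ψ (Matrix.vecCons (x + r) Y)‖ * ‖Ψ.ψ (Matrix.vecCons x Y)‖) ∧
    (∀ r : Space, 0 < ∫ x in cell L, ∫ Y in cellN n L,
        ‖Ψ.ψ (Matrix.vecCons (x + r) Y)‖ * ‖Ψ.ψ (Matrix.vecCons x Y)‖) ∧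
    (∀ r : Space, (∫ x in cell L, ∫ Y in cellN n L,
        ‖Ψ.ψ (Matrix.vecCons (x + r) Y)‖ * ‖Ψ.ψ (Matrix.vecCons x Y)‖) ≤ 1) ∧
    (∫ x in cell L, ∫ Y in cellN n L,
        ‖Ψ.ψ (Matrix.vecCons (x + 0) Y)‖ * ‖Ψ.ψ (Matrix.vecCons x Y)‖) = 1 ∧
    (∀ r : Space, (∫ x in cell L, ∫ Y in cellN n L,
        ‖Ψ.ψ (Matrix.vecCons (x + -r) Y)‖ * ‖Ψ.ψ (Matrix.vecCons x Y)‖) =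
      ∫ x in cell L, ∫ Y in cellN n L,
        ‖Ψ.ψ (Matrix.vecCons (x + r) Y)‖ * ‖Ψ.ψ (Matrix.vecCons x Y)‖) ∧
    (∀ (r : Space) (k : Fin 3), (∫ x in cell L, ∫ Y in cellN n L,
        ‖Ψ.ψ (Matrix.vecCons (x + (r + EuclideanSpace.single k L)) Y)‖ * ‖Ψ.ψ (Matrix.vecCons x Y)‖) =
      ∫ x in cell L, ∫ Y in cellN n L,
        ‖Ψ.ψ (Matrix.vecCons (x + r) Y)‖ * ‖Ψ.ψ (Matrix.vecCons x Y)‖)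

/-- **PhaseSteinDomination** (PSD; statement of the registered stub `stub_phaseSteinDomination`, the OPEN
core of FD; open-problem strength): under the crux hypotheses PLUS the weak Euler–Lagrange identity of the
minimiser and the continuity/positivity of its coherence, for every `m ≠ 0` there is a `C¹` field `φ` with
`16 ν_m ≤ C · J^S_m(φ)`, `J^S_m(φ) = −(4/N) Re ∫ (N ∂φ(Z_m) − ∂̄φ(Z_m) Z̄^{(2)}_m)|Ψ|² − ∫ |φ(Z_m)|²|Ψ|²`.
Crux-sized: `phaseSteinDomination_of_imu` and `imu_of_phaseStein_of_fisherGaussianity`. A statement,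
not a fact. -/
def PhaseSteinDomination : Prop :=
  ∀ v : ℝ → ℝ≥0∞, IsRepulsiveFiniteRange v → (∀ r, v r ≠ ⊤) →
    ContDiff ℝ 2 (fun x : Space => (v ‖x‖).toReal) →
    (∃ Cₑ : ℝ, ∀ x : Space,
      ‖iteratedFDeriv ℝ 2 (fun x : Space => (v ‖x‖).toReal) x‖ ≤ Cₑ * Real.sqrt ((v ‖x‖).toReal)) →
    ∃ C : ℝ, 0 ≤ C ∧ ∃ ρ₀ : ℝ, 0 < ρ₀ ∧ ∀ ρ : ℝ, 0 < ρ → ρ < ρ₀ → ∀ᶠ n : ℕ in Filter.atTop,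
      ∀ Ψ : PeriodicTrialState (n + 1) (sideLength ρ (n + 1)),
        periodicEnergy v Ψ = periodicGroundStateEnergy v (n + 1) (sideLength ρ (n + 1)) →
        periodicEnergy v Ψ ≠ ⊤ → (∀ X, Ψ.ψ X = (‖Ψ.ψ X‖ : ℂ)) → (∀ X, Ψ.ψ X ≠ 0) →
        (∀ η : Config (n + 1) → ℂ, ContDiff ℝ 1 η →
          (∀ (X : Config (n + 1)) (i : Fin (n + 1)) (k : Fin 3),
            η (X + Pi.single i (EuclideanSpace.single k (sideLength ρ (n + 1)))) = η X) →
          (∀ (σ : Equiv.Perm (Fin (n + 1))) (X : Config (n + 1)), η (X ∘ σ) = η X) →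
          (∫ X in cellN (n + 1) (sideLength ρ (n + 1)),
              ((∑ i : Fin (n + 1), ∑ k : Fin 3,
                  (starRingEnd ℂ (fderiv ℝ η X (Pi.single i (EuclideanSpace.single k (1 : ℝ)))) *
                    fderiv ℝ Ψ.ψ X (Pi.single i (EuclideanSpace.single k (1 : ℝ)))).re) +
                (periodicInteraction v (sideLength ρ (n + 1)) X).toReal *
                  (starRingEnd ℂ (η X) * Ψ.ψ X).re)) =
            (periodicGroundStateEnergy v (n + 1) (sideLength ρ (n + 1))).toReal *
              ∫ X in cellN (n + 1) (sideLength ρ (n + 1)), (starRingEnd ℂ (η X) * Ψ.ψ X).re) →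
        Continuous (fun r : Space => ∫ x in cell (sideLength ρ (n + 1)), ∫ Y in cellN n (sideLength ρ (n + 1)),
            ‖Ψ.ψ (Matrix.vecCons (x + r) Y)‖ * ‖Ψ.ψ (Matrix.vecCons x Y)‖) →
        (∀ r : Space, 0 < ∫ x in cell (sideLength ρ (n + 1)), ∫ Y in cellN n (sideLength ρ (n + 1)),
            ‖Ψ.ψ (Matrix.vecCons (x + r) Y)‖ * ‖Ψ.ψ (Matrix.vecCons x Y)‖) →
        ∀ m : Fin 3 → ℤ, m ≠ 0 →
          ∃ φ : ℂ → ℂ, ContDiff ℝ 1 φ ∧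
            16 * (cellFourierCoeff (sideLength ρ (n + 1)) (fun r : Space => ((Real.log
              (∫ x in cell (sideLength ρ (n + 1)), ∫ Y in cellN n (sideLength ρ (n + 1)),
                ‖Ψ.ψ (Matrix.vecCons (x + r) Y)‖ * ‖Ψ.ψ (Matrix.vecCons x Y)‖) : ℝ) : ℂ)) m).re ≤
            C * (-(4 / ((n : ℝ) + 1)) *
                  (∫ X in cellN (n + 1) (sideLength ρ (n + 1)),
                    ((((n : ℝ) + 1 : ℝ) : ℂ) *
                        ((fderiv ℝ φ (∑ j : Fin (n + 1), cellWave (sideLength ρ (n + 1)) m (X j)) 1 -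
                            Complex.I * fderiv ℝ φ (∑ j : Fin (n + 1), cellWave (sideLength ρ (n + 1)) m (X j))
                              Complex.I) / 2) -
                      (fderiv ℝ φ (∑ j : Fin (n + 1), cellWave (sideLength ρ (n + 1)) m (X j)) 1 +
                            Complex.I * fderiv ℝ φ (∑ j : Fin (n + 1), cellWave (sideLength ρ (n + 1)) m (X j))
                              Complex.I) / 2 *
                        starRingEnd ℂ (∑ j : Fin (n + 1), cellWave (sideLength ρ (n + 1)) m (X j) ^ 2)).re *
                      ‖Ψ.ψ X‖ ^ 2) -
                ∫ X in cellN (n + 1) (sideLength ρ (n + 1)),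
                  ‖φ (∑ j : Fin (n + 1), cellWave (sideLength ρ (n + 1)) m (X j))‖ ^ 2 * ‖Ψ.ψ X‖ ^ 2)

/-! ## Three of the four are theorems of the tree -/

/-- `SteinIdentity` holds (landed stub `Theorems.ImuSteinIdentity.stub_steinIdentity`, p77744). -/
theorem steinIdentity_holds : SteinIdentity :=
  Summit.AtomisticToContinuum.BoseEinsteinCondensation.Theorems.ImuSteinIdentity.stub_steinIdentity

/-- `WeakEulerLagrange` holds (landed stub `Theorems.ImuWeakEulerLagrange.stub_weakEulerLagrange`, p78669). -/
theorem weakEulerLagrange_holds : WeakEulerLagrange :=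
  Summit.AtomisticToContinuum.BoseEinsteinCondensation.Theorems.ImuWeakEulerLagrange.stub_weakEulerLagrange

/-- `CoherenceRegular` holds (landed stub `Theorems.BECConjugateDomination.stub_coherenceRegular`, p77078). -/
theorem coherenceRegular_holds : CoherenceRegular :=
  Summit.AtomisticToContinuum.BoseEinsteinCondensation.Theorems.BECConjugateDomination.stub_coherenceRegular

/-! ## The cut and its glue -/

/-- **The Stein identity turns `J` into its derivative-free form** (inline right-hand side, as in
`PhaseSteinDomination`): for a real state, a `C¹` field and `m ≠ 0`. -/
theorem fisherTestV_eq_steinInline (hS : SteinIdentity) {n : ℕ} {L : ℝ} (hL : 0 < L)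
    (Ψ : PeriodicTrialState (n + 1) L) (hreal : ∀ X, Ψ.ψ X = (‖Ψ.ψ X‖ : ℂ))
    {m : Fin 3 → ℤ} (hm : m ≠ 0) {φ : ℂ → ℂ} (hφ : ContDiff ℝ 1 φ) :
    fisherTestV n L Ψ m φ =
      -(4 / ((n : ℝ) + 1)) *
          (∫ X in cellN (n + 1) L,
            ((((n : ℝ) + 1 : ℝ) : ℂ) *
                ((fderiv ℝ φ (∑ j : Fin (n + 1), cellWave L m (X j)) 1 -
                    Complex.I * fderiv ℝ φ (∑ j : Fin (n + 1), cellWave L m (X j)) Complex.I) / 2) -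
              (fderiv ℝ φ (∑ j : Fin (n + 1), cellWave L m (X j)) 1 +
                    Complex.I * fderiv ℝ φ (∑ j : Fin (n + 1), cellWave L m (X j)) Complex.I) / 2 *
                starRingEnd ℂ (∑ j : Fin (n + 1), cellWave L m (X j) ^ 2)).re * ‖Ψ.ψ X‖ ^ 2) -
        ∫ X in cellN (n + 1) L, ‖φ (∑ j : Fin (n + 1), cellWave L m (X j))‖ ^ 2 * ‖Ψ.ψ X‖ ^ 2 := by
  have hk := norm_waveVec_pos hL hm
  have hN : (0 : ℝ) < (n : ℝ) + 1 := by positivity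
  have hP : (∫ X in cellN (n + 1) L, (starRingEnd ℂ (φ (densityMode (n + 1) L m X)) *
      commutatorAmp (n + 1) L Ψ.ψ m X * starRingEnd ℂ (Ψ.ψ X)).re) =
      ‖waveVec L m‖ ^ 2 * ∫ X in cellN (n + 1) L,
            ((((n : ℝ) + 1 : ℝ) : ℂ) *
                ((fderiv ℝ φ (∑ j : Fin (n + 1), cellWave L m (X j)) 1 -
                    Complex.I * fderiv ℝ φ (∑ j : Fin (n + 1), cellWave L m (X j)) Complex.I) / 2) -
              (fderiv ℝ φ (∑ j : Fin (n + 1), cellWave L m (X j)) 1 +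
                    Complex.I * fderiv ℝ φ (∑ j : Fin (n + 1), cellWave L m (X j)) Complex.I) / 2 *
                starRingEnd ℂ (∑ j : Fin (n + 1), cellWave L m (X j) ^ 2)).re * ‖Ψ.ψ X‖ ^ 2 :=
    hS n L hL Ψ hreal m φ hφ
  unfold fisherTestV
  rw [hP]
  unfold densityMode
  field_simp

/-- **The lead's cut of FD**: SteinIdentity ∧ WeakEulerLagrange ∧ CoherenceRegular ∧ PhaseSteinDomination
⇒ FisherDominationV (same `C`, same `ρ₀`; the `C¹` witness field is continuous). -/
theorem fisherDominationV_of_parts (hS : SteinIdentity) (hEL : WeakEulerLagrange)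
    (hG : CoherenceRegular) (hP : PhaseSteinDomination) : FisherDominationV := by
  intro v hv₁ hv₂ hv₃ hv₄
  obtain ⟨C, hC, ρ₀, hρ₀, h⟩ := hP v hv₁ hv₂ hv₃ hv₄
  refine ⟨C, hC, ρ₀, hρ₀, fun ρ hρ hρ' => ?_⟩
  filter_upwards [h ρ hρ hρ'] with n hn
  intro Ψ hE hfin hreal hpos m hm
  have hL : 0 < sideLength ρ (n + 1) := sideLength_succ_pos hρ n
  have hELΨ := hEL v hv₁ hv₂ hv₃ hv₄ n (sideLength ρ (n + 1)) hL Ψ hE hfin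
  obtain ⟨hgc, hgpos, -, -, -, -⟩ := hG n (sideLength ρ (n + 1)) hL Ψ hpos
  obtain ⟨φ, hφ, hbound⟩ := hn Ψ hE hfin hreal hpos hELΨ hgc hgpos m hm
  refine ⟨φ, hφ.continuous, ?_⟩
  rw [fisherTestV_eq_steinInline hS hL Ψ hreal hm hφ]
  exact hbound

/-- **Sufficiency of the open core with FG**: PSD ∧ FG ⇒ IMU (the three provable stubs being theorems,
via the tree's `imu_of_fisher`; constants `C = C_PSD · C_FG / 16`). -/
theorem imu_of_phaseStein_of_fisherGaussianity :
    PhaseSteinDomination → FisherGaussianityV → InfraredMinimumUncertainty := fun hP hFG =>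
  infraredMinimumUncertainty_iff_named.mp
    (imu_of_fisher
      (fisherDominationV_of_parts steinIdentity_holds weakEulerLagrange_holds coherenceRegular_holds hP) hFG)

/-- **Necessity of the open core**: IMU(C₀) ⇒ PSD(4C₀ + 4), the witness being the LINEAR (hence `C¹`) field
`φ_λ(z) = −λz` (`J^S(φ_λ) = 4λ − λ²·N S_m` by a direct Wirtinger computation on the linear field and the f-sum
rule). LANDED by the drefute seat as `Theorems.InfraredMinimumUncertainty.Negative.stub_phaseSteinDomination_of_imu`
(p82312, conclusion = the registered signature of `stub_phaseSteinDomination` verbatim); recorded here over the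
named statement. So no witness can refute PSD without refuting the crux: PSD ⟺ IMU modulo FG. -/
theorem phaseSteinDomination_of_imu : InfraredMinimumUncertainty → PhaseSteinDomination :=
  Summit.AtomisticToContinuum.BoseEinsteinCondensation.Theorems.InfraredMinimumUncertainty.Negative.stub_phaseSteinDomination_of_imu

end Summit.AtomisticToContinuum.BoseEinsteinCondensation.Cruxes.InfraredMinimumUncertainty.FisherGaussianDensityMode

end
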